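import Literature.Geometry.Riemannian.MeanConvexFermiHessian
import Literature.Geometry.Riemannian.MeanConvexFlatFrameSum
import Mathlib.Analysis.InnerProductSpace.Adjoint

/-!
# The tangent-frame sum of `Φ(‖Y‖, t)` for general Fermi data

Topic `Geometry/Riemannian` (fact seat
`provefact-Literature.Geometry.Riemannian.LawsonMichelsohn1984_surrounding`).  Everything here
is **proved**; no definitions.

Companion of `MeanConvexFlatFrameSum.lean` (flat data) and `MeanConvexFramePerturbation.lean`
(the scalar stability estimate): for **arbitrary** `C²` Fermi data `Y : E → F`, `t : E → ℝ` and
a `C²` planar profile `Φ`, at a point `x` with `y = Y x ≠ 0`, `r = ‖y‖`, `ŷ = r⁻¹ y`,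
`L = DY(x)`, `a = L† ŷ`, `b = ∇t(x)`, `g = Φ_r a + Φ_t b` (`= ∇G(x)`, `G = Φ ∘ (‖Y‖, t)`), the
tangent-frame sum of `D²G(x)` over an orthonormal frame `v` of `ker dG(x)` is

`∑ᵢ D²G(vᵢ, vᵢ) = tr M - M(g, g)/‖g‖² + ∑ᵢ [Φ_r ⟨ŷ, D²Y(vᵢ, vᵢ)⟩ + Φ_t D²t(vᵢ, vᵢ)]`,

where `M(u, w) = D²Φ((⟨a,u⟩, ⟨b,u⟩), (⟨a,w⟩, ⟨b,w⟩)) + (Φ_r/r)(⟨L u, L w⟩ - ⟨a,u⟩⟨a,w⟩)` is the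
part of the Hessian not involving second derivatives of the data, with
`tr M = Φ_rr ‖a‖² + (Φ_rt + Φ_tr)⟨a, b⟩ + Φ_tt ‖b‖² + (Φ_r/r)(∑ⱼ ‖L bⱼ‖² - ‖a‖²)` (double Parseval)
and `M(g, g)` explicit (`frameSum_fermiFun`).  For the flat data (`L` a co-isometry, `b` a unit
vector with `L b = 0`) the scalar part is the value `Q_k(Φ)` of `frameSum_biradial`; in general
it is controlled by `abs_scalarFrameSum_sub_flat_le`, and the remaining sum carries the
curvature of the data (the term `Φ_t ∑ᵢ D²t(vᵢ, vᵢ)` is the mean curvature of `Σ = {t = 0}`,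
which makes the far zone of the junction work).

* `fderiv_fermiFun_apply` — `dG(x) u = Φ_r ⟨a, u⟩ + Φ_t ⟨b, u⟩`;
* `frameSum_fermiFun` — the identity above (`MeanConvexFermiHessian.fderiv_fderiv_fermiFun_apply`
  with the frame-sum identities of `MeanConvexFrameSum`).

## References

* H. B. Lawson, Jr., M.-L. Michelsohn, *Embedding and surrounding with positive mean curvature*,
  Invent. Math. 77 (1984), §3. [LawsonMichelsohn1984]
-/

noncomputable section

open Set Function Filter Module
open scoped Topology RealInnerProductSpace

namespace Literature.Geometry.Riemannian

variable {E F : Type*} [NormedAddCommGroup E] [InnerProductSpace ℝ E] [FiniteDimensional ℝ E]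
  [NormedAddCommGroup F] [InnerProductSpace ℝ F] [CompleteSpace F]

section Fermi

variable (Φ : ℝ × ℝ → ℝ) (Y : E → F) (t : E → ℝ) {m : ℕ}

/-- **The differential of `G = Φ ∘ (‖Y‖, t)`** at a point with `Y x ≠ 0`:
`dG(x) u = Φ_r ⟨L† ŷ, u⟩ + Φ_t ⟨∇t, u⟩` (`L = DY(x)`, `ŷ = ‖Y x‖⁻¹ Y x`). [folklore] -/
theorem fderiv_fermiFun_apply {x : E} (hY : DifferentiableAt ℝ Y x) (ht : DifferentiableAt ℝ t x)
    (hx : Y x ≠ 0) (hΦ : DifferentiableAt ℝ Φ (‖Y x‖, t x)) (u : E) :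
    fderiv ℝ (fun z => Φ (‖Y z‖, t z)) x u =
      fderiv ℝ Φ (‖Y x‖, t x) (1, 0) * ⟪(fderiv ℝ Y x).adjoint (‖Y x‖⁻¹ • Y x), u⟫ +
        fderiv ℝ Φ (‖Y x‖, t x) (0, 1) * ⟪(InnerProductSpace.toDual ℝ E).symm (fderiv ℝ t x), u⟫ := by
  haveI : CompleteSpace E := FiniteDimensional.complete ℝ E
  have hnd : DifferentiableAt ℝ (fun z => ‖Y z‖) x :=
    (Literature.Analysis.Potential.HyperbolicBall.hasFDerivAt_norm_of_ne_zero hx).differentiableAt.comp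
      x hY
  have hψd : DifferentiableAt ℝ (fun z => (‖Y z‖, t z)) x := hnd.prodMk ht
  rw [show (fun z => Φ (‖Y z‖, t z)) = Φ ∘ fun z => (‖Y z‖, t z) from rfl,
    fderiv_comp x hΦ hψd, ContinuousLinearMap.comp_apply, hnd.fderiv_prodMk ht]
  simp only [ContinuousLinearMap.prod_apply]
  rw [fderiv_norm_comp_apply hY hx u, clm_prod_apply_eq, ContinuousLinearMap.adjoint_inner_left,
    InnerProductSpace.toDual_symm_apply]
  ring

set_option maxHeartbeats 800000 in
/-- **The tangent-frame sum of `Φ(‖Y‖, t)` for general Fermi data.**  Let `dim E = m + 1`,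
`Y`, `t` be `C²` at `x` with `y = Y x ≠ 0`, `Φ` be `C²` at `(r, t x)`, `r = ‖y‖`, and assume
`dG(x) ≠ 0`, `G = Φ ∘ (‖Y‖, t)`.  With `ŷ = r⁻¹ y`, `L = DY(x)`, `a = L† ŷ`, `b = ∇t(x)`,
`g = Φ_r a + Φ_t b`, `A = Φ_rr`, `B = Φ_rt + Φ_tr`, `C = Φ_tt`, and the standard orthonormal
basis `(bⱼ)` of `E`, for every orthonormal `m`-frame `v` of `ker dG(x)`:
`∑ᵢ D²G(vᵢ, vᵢ) = [A‖a‖² + B⟨a,b⟩ + C‖b‖² + (Φ_r/r)(∑ⱼ‖L bⱼ‖² - ‖a‖²)]`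
`- [A⟨a,g⟩² + B⟨a,g⟩⟨b,g⟩ + C⟨b,g⟩² + (Φ_r/r)(‖L g‖² - ⟨a,g⟩²)] / ‖g‖²`
`+ ∑ᵢ [Φ_r ⟨ŷ, D²Y(vᵢ, vᵢ)⟩ + Φ_t D²t(vᵢ, vᵢ)]`. [cite: LawsonMichelsohn1984, §3] -/
theorem frameSum_fermiFun (hE : finrank ℝ E = m + 1) {x : E} (hY : ContDiffAt ℝ 2 Y x)
    (ht : ContDiffAt ℝ 2 t x) (hx : Y x ≠ 0) (hΦ : ContDiffAt ℝ 2 Φ (‖Y x‖, t x))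
    (hdG : fderiv ℝ (fun z => Φ (‖Y z‖, t z)) x ≠ 0) {v : Fin m → E} (hv : Orthonormal ℝ v)
    (hvf : ∀ i, fderiv ℝ (fun z => Φ (‖Y z‖, t z)) x (v i) = 0) :
    ∑ i, iteratedFDeriv ℝ 2 (fun z => Φ (‖Y z‖, t z)) x ![v i, v i] =
      (fderiv ℝ (fderiv ℝ Φ) (‖Y x‖, t x) (1, 0) (1, 0) *
            ‖(fderiv ℝ Y x).adjoint (‖Y x‖⁻¹ • Y x)‖ ^ 2 +
          (fderiv ℝ (fderiv ℝ Φ) (‖Y x‖, t x) (1, 0) (0, 1) +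
              fderiv ℝ (fderiv ℝ Φ) (‖Y x‖, t x) (0, 1) (1, 0)) *
            ⟪(fderiv ℝ Y x).adjoint (‖Y x‖⁻¹ • Y x),
              (InnerProductSpace.toDual ℝ E).symm (fderiv ℝ t x)⟫ +
          fderiv ℝ (fderiv ℝ Φ) (‖Y x‖, t x) (0, 1) (0, 1) *
            ‖(InnerProductSpace.toDual ℝ E).symm (fderiv ℝ t x)‖ ^ 2 +
          fderiv ℝ Φ (‖Y x‖, t x) (1, 0) / ‖Y x‖ *
            (∑ j, ‖fderiv ℝ Y x (stdOrthonormalBasis ℝ E j)‖ ^ 2 -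
              ‖(fderiv ℝ Y x).adjoint (‖Y x‖⁻¹ • Y x)‖ ^ 2)) -
        (fderiv ℝ (fderiv ℝ Φ) (‖Y x‖, t x) (1, 0) (1, 0) *
              ⟪(fderiv ℝ Y x).adjoint (‖Y x‖⁻¹ • Y x),
                fderiv ℝ Φ (‖Y x‖, t x) (1, 0) • (fderiv ℝ Y x).adjoint (‖Y x‖⁻¹ • Y x) +
                  fderiv ℝ Φ (‖Y x‖, t x) (0, 1) •
                    (InnerProductSpace.toDual ℝ E).symm (fderiv ℝ t x)⟫ ^ 2 +
            (fderiv ℝ (fderiv ℝ Φ) (‖Y x‖, t x) (1, 0) (0, 1) +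
                fderiv ℝ (fderiv ℝ Φ) (‖Y x‖, t x) (0, 1) (1, 0)) *
              ⟪(fderiv ℝ Y x).adjoint (‖Y x‖⁻¹ • Y x),
                fderiv ℝ Φ (‖Y x‖, t x) (1, 0) • (fderiv ℝ Y x).adjoint (‖Y x‖⁻¹ • Y x) +
                  fderiv ℝ Φ (‖Y x‖, t x) (0, 1) •
                    (InnerProductSpace.toDual ℝ E).symm (fderiv ℝ t x)⟫ *
              ⟪(InnerProductSpace.toDual ℝ E).symm (fderiv ℝ t x),
                fderiv ℝ Φ (‖Y x‖, t x) (1, 0) • (fderiv ℝ Y x).adjoint (‖Y x‖⁻¹ • Y x) +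
                  fderiv ℝ Φ (‖Y x‖, t x) (0, 1) •
                    (InnerProductSpace.toDual ℝ E).symm (fderiv ℝ t x)⟫ +
            fderiv ℝ (fderiv ℝ Φ) (‖Y x‖, t x) (0, 1) (0, 1) *
              ⟪(InnerProductSpace.toDual ℝ E).symm (fderiv ℝ t x),
                fderiv ℝ Φ (‖Y x‖, t x) (1, 0) • (fderiv ℝ Y x).adjoint (‖Y x‖⁻¹ • Y x) +
                  fderiv ℝ Φ (‖Y x‖, t x) (0, 1) •
                    (InnerProductSpace.toDual ℝ E).symm (fderiv ℝ t x)⟫ ^ 2 +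
          fderiv ℝ Φ (‖Y x‖, t x) (1, 0) / ‖Y x‖ *
            (‖fderiv ℝ Y x
                  (fderiv ℝ Φ (‖Y x‖, t x) (1, 0) • (fderiv ℝ Y x).adjoint (‖Y x‖⁻¹ • Y x) +
                    fderiv ℝ Φ (‖Y x‖, t x) (0, 1) •
                      (InnerProductSpace.toDual ℝ E).symm (fderiv ℝ t x))‖ ^ 2 -
              ⟪(fderiv ℝ Y x).adjoint (‖Y x‖⁻¹ • Y x),
                fderiv ℝ Φ (‖Y x‖, t x) (1, 0) • (fderiv ℝ Y x).adjoint (‖Y x‖⁻¹ • Y x) +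
                  fderiv ℝ Φ (‖Y x‖, t x) (0, 1) •
                    (InnerProductSpace.toDual ℝ E).symm (fderiv ℝ t x)⟫ ^ 2)) /
          ‖fderiv ℝ Φ (‖Y x‖, t x) (1, 0) • (fderiv ℝ Y x).adjoint (‖Y x‖⁻¹ • Y x) +
              fderiv ℝ Φ (‖Y x‖, t x) (0, 1) • (InnerProductSpace.toDual ℝ E).symm (fderiv ℝ t x)‖ ^ 2 +
      ∑ i, (fderiv ℝ Φ (‖Y x‖, t x) (1, 0) *
          ⟪‖Y x‖⁻¹ • Y x, fderiv ℝ (fderiv ℝ Y) x (v i) (v i)⟫ +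
        fderiv ℝ Φ (‖Y x‖, t x) (0, 1) * fderiv ℝ (fderiv ℝ t) x (v i) (v i)) := by
  haveI : CompleteSpace E := FiniteDimensional.complete ℝ E
  -- names
  set y : F := Y x with hy
  set r : ℝ := ‖y‖ with hr
  obtain ⟨yh, hyh⟩ : ∃ yh : F, yh = r⁻¹ • y := ⟨_, rfl⟩
  set L : E →L[ℝ] F := fderiv ℝ Y x with hL
  set ℓ : E →L[ℝ] ℝ := fderiv ℝ t x with hℓ
  obtain ⟨a, ha⟩ : ∃ a : E, a = L.adjoint yh := ⟨_, rfl⟩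
  obtain ⟨bv, hbv⟩ : ∃ bv : E, bv = (InnerProductSpace.toDual ℝ E).symm ℓ := ⟨_, rfl⟩
  set p : ℝ × ℝ := (r, t x) with hp
  set Φr : ℝ := fderiv ℝ Φ p (1, 0) with hΦr
  set Φt : ℝ := fderiv ℝ Φ p (0, 1) with hΦt
  set H := fderiv ℝ (fderiv ℝ Φ) p with hH
  set BY := fderiv ℝ (fderiv ℝ Y) x with hBY
  set Bt := fderiv ℝ (fderiv ℝ t) x with hBt
  obtain ⟨g, hg⟩ : ∃ g : E, g = Φr • a + Φt • bv := ⟨_, rfl⟩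
  set G : E → ℝ := fun z => Φ (‖Y z‖, t z) with hG
  rw [← hyh, ← ha, ← hbv, ← hg]
  -- first derivative
  have hYd : DifferentiableAt ℝ Y x := hY.differentiableAt (by simp)
  have htd : DifferentiableAt ℝ t x := ht.differentiableAt (by simp)
  have hΦd : DifferentiableAt ℝ Φ p := hΦ.differentiableAt (by simp)
  have hdGu : ∀ u, fderiv ℝ G x u = ⟪g, u⟫ := fun u => by
    rw [hG, fderiv_fermiFun_apply Φ Y t hYd htd hx hΦd u, ← hyh, ← ha, ← hbv, hg, inner_add_left,
      real_inner_smul_left, real_inner_smul_left]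
  have hgdual : (InnerProductSpace.toDual ℝ E).symm (fderiv ℝ G x) = g := by
    apply (InnerProductSpace.toDual ℝ E).injective
    rw [LinearIsometryEquiv.apply_symm_apply]
    ext u
    rw [InnerProductSpace.toDual_apply_apply, hdGu u]
  have hgne : g ≠ 0 := by
    intro h0
    apply hdG
    ext u
    rw [hdGu u, h0, inner_zero_left]; rfl
  have hvg : ∀ i, ⟪v i, g⟫ = 0 := fun i => by rw [real_inner_comm, ← hdGu (v i)]; exact hvf i
  -- the Hessian
  have hinner_a : ∀ u, ⟪yh, L u⟫ = ⟪a, u⟫ := fun u => by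
    rw [ha, ContinuousLinearMap.adjoint_inner_left]
  have hinner_b : ∀ u, ℓ u = ⟪bv, u⟫ := fun u => by
    rw [hbv, InnerProductSpace.toDual_symm_apply]
  have hHv : ∀ u w : E, iteratedFDeriv ℝ 2 G x ![u, w] =
      H (⟪a, u⟫, ⟪bv, u⟫) (⟪a, w⟫, ⟪bv, w⟫) +
        Φr * ((⟪L u, L w⟫ - ⟪a, u⟫ * ⟪a, w⟫) / r) +
        (Φr * ⟪yh, BY u w⟫ + Φt * Bt u w) := by
    intro u w
    rw [iteratedFDeriv_two_vecCons]
    have h := fderiv_fderiv_fermiFun_apply (Φ := Φ) (Y := Y) (t := t) hY ht hx hΦ u w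
    have e : fderiv ℝ (fderiv ℝ G) x u w = fderiv ℝ (fun z => fderiv ℝ (fun z => Φ (‖Y z‖, t z)) z) x u w :=
      rfl
    rw [e, h, ← hy, ← hr, ← hyh, ← hL, ← hℓ, hinner_a, hinner_a, hinner_b, hinner_b]
    show H (⟪a, u⟫, ⟪bv, u⟫) (⟪a, w⟫, ⟪bv, w⟫) +
        Φr * ((⟪L u, L w⟫ - ⟪a, u⟫ * ⟪a, w⟫) / r + ⟪yh, BY u w⟫) + Φt * Bt u w = _
    ring
  -- the `B`-part as a bilinear form
  set Bform : E →ₗ[ℝ] E →ₗ[ℝ] ℝ :=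
    (ContinuousLinearMap.coeLM ℝ).comp
      (Φr • ((ContinuousLinearMap.compL ℝ E F ℝ (innerSL ℝ yh)).comp BY) + Φt • Bt).toLinearMap
    with hBform
  have hBapp : ∀ u w, Bform u w = Φr * ⟪yh, BY u w⟫ + Φt * Bt u w := fun u w => rfl
  -- the two frame-sum identities
  set b := stdOrthonormalBasis ℝ E with hb
  have key1 := sum_iteratedFDeriv_two_ker_eq hE hdG b hv hvf
  rw [hgdual] at key1
  have key2 := sum_apply_orthonormal_ker_eq hE Bform b hgne hv hvg
  -- the trace of the `M`-part
  have htrM : ∑ j, (H (⟪a, b j⟫, ⟪bv, b j⟫) (⟪a, b j⟫, ⟪bv, b j⟫) +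
      Φr * ((⟪L (b j), L (b j)⟫ - ⟪a, b j⟫ * ⟪a, b j⟫) / r)) =
      H (1, 0) (1, 0) * ‖a‖ ^ 2 + (H (1, 0) (0, 1) + H (0, 1) (1, 0)) * ⟪a, bv⟫ +
        H (0, 1) (0, 1) * ‖bv‖ ^ 2 + Φr / r * (∑ j, ‖L (b j)‖ ^ 2 - ‖a‖ ^ 2) := by
    have hj : ∀ j, H (⟪a, b j⟫, ⟪bv, b j⟫) (⟪a, b j⟫, ⟪bv, b j⟫) +
        Φr * ((⟪L (b j), L (b j)⟫ - ⟪a, b j⟫ * ⟪a, b j⟫) / r) =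
        ⟪a, b j⟫ ^ 2 * H (1, 0) (1, 0) + ⟪a, b j⟫ * ⟪bv, b j⟫ * (H (1, 0) (0, 1) + H (0, 1) (1, 0)) +
          ⟪bv, b j⟫ ^ 2 * H (0, 1) (0, 1) + Φr / r * ‖L (b j)‖ ^ 2 - Φr / r * ⟪a, b j⟫ ^ 2 := by
      intro j
      rw [clm_prod_apply_apply_eq, real_inner_self_eq_norm_sq]
      ring
    rw [Finset.sum_congr rfl fun j _ => hj j, Finset.sum_sub_distrib, Finset.sum_add_distrib,
      Finset.sum_add_distrib, Finset.sum_add_distrib, ← Finset.sum_mul, ← Finset.sum_mul,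
      ← Finset.sum_mul, ← Finset.mul_sum, ← Finset.mul_sum]
    have h1 : ∑ j, ⟪a, b j⟫ ^ 2 = ‖a‖ ^ 2 := b.sum_sq_inner_left a
    have h2 : ∑ j, ⟪bv, b j⟫ ^ 2 = ‖bv‖ ^ 2 := b.sum_sq_inner_left bv
    have h3 : ∑ j, ⟪a, b j⟫ * ⟪bv, b j⟫ = ⟪a, bv⟫ := by
      rw [← b.sum_inner_mul_inner a bv]
      exact Finset.sum_congr rfl fun j _ => by rw [real_inner_comm (b j) bv]
    rw [h1, h2, h3]
    ring
  -- assemble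
  have hsum1 : ∑ j, iteratedFDeriv ℝ 2 G x ![b j, b j] =
      (H (1, 0) (1, 0) * ‖a‖ ^ 2 + (H (1, 0) (0, 1) + H (0, 1) (1, 0)) * ⟪a, bv⟫ +
        H (0, 1) (0, 1) * ‖bv‖ ^ 2 + Φr / r * (∑ j, ‖L (b j)‖ ^ 2 - ‖a‖ ^ 2)) +
      ∑ j, Bform (b j) (b j) := by
    rw [← htrM, ← Finset.sum_add_distrib]
    exact Finset.sum_congr rfl fun j _ => by rw [hHv, hBapp]
  have hgg : iteratedFDeriv ℝ 2 G x ![g, g] =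
      (H (1, 0) (1, 0) * ⟪a, g⟫ ^ 2 + (H (1, 0) (0, 1) + H (0, 1) (1, 0)) * ⟪a, g⟫ * ⟪bv, g⟫ +
        H (0, 1) (0, 1) * ⟪bv, g⟫ ^ 2 + Φr / r * (‖L g‖ ^ 2 - ⟪a, g⟫ ^ 2)) + Bform g g := by
    rw [hHv, hBapp, clm_prod_apply_apply_eq, real_inner_self_eq_norm_sq]
    ring
  have hframeB : ∑ i, (Φr * ⟪yh, BY (v i) (v i)⟫ + Φt * Bt (v i) (v i)) = ∑ i, Bform (v i) (v i) :=
    Finset.sum_congr rfl fun i _ => by rw [hBapp]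
  rw [key1, hsum1, hgg, hframeB, key2]
  ring

end Fermi

end Literature.Geometry.Riemannian

end
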